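import Literature.NumberTheory.EllipticCurves.Cm7QuadraticTwistGoodAtTwo
import Literature.NumberTheory.EllipticCurves.BertrandCMHeightNonvanishingTwo
import Literature.NumberTheory.EllipticCurves.KellerYin2024.PotentiallyGoodOrdinaryPConverse
import Summits.BirchSwinnertonDyer.Rank1Residual.X12.CMDeuringTwo
import HarnessLib

/-!
# Road (C) / `disegni-pair-two` on crux stmt-BirchSwinnertonDyer-20368: the absorbed twist `A′ = 49a1^{(d′)}`, `d′ ≡ 1 (mod 4)`,
# is good ORDINARY at `2` («CM & split ⇒ ordinary», planner g24 ENTRY-TICKET §2) — the Disegni Thm B hypothesis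
# «A/F_v potentially 𝔭-ordinary good» at the road-(C) point, BY NAME

Cell `bsd-print-cf2` (`run/shared/lean/pub/bsd-print-cf2/`), width seat `bsd-line-cf2-p1-w5` g19 (recipe: `bsd-line-cf2-p1-w7` g20,
STATUS 15:55:11Z); `--supports stmt-BirchSwinnertonDyer-20368 --as helper`. THEOREMS ONLY (no definition, no named fact, no instance,
no `sorry`). Inputs, all tree theorems: `cm7_quadraticTwist_hasGoodReductionAtPrime_two` (this seat: the twists by `d ≡ 1 (4)` are GOOD at
`2`), `X12.goodOrd_two_of_cmFieldDiscrOfJ_eq_neg_seven` (`j ∈ {−3375, 16581375}` and good at `2` ⇒ `a_2` odd — Deuring at `2`,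
Lang Ch. 13 §4 Thm 12), `cm7Twist_j` (`j(W_k) = −3375`, cell bsd-goldfeld) and `hasPotentiallyGoodOrdinaryReductionAtPrime_of_goodOrd`
(Keller–Yin bridge). HONEST FRAMING: hypothesis bookkeeping for a line not yet registered; no summit statement is proved; BSD is not advanced.
-/

noncomputable section

open scoped Classical

-- the summit namespace repeats the problem name by design (D-0017)
set_option linter.dupNamespace false

open WeierstrassCurve Literature.NumberTheory.EllipticCurves Literature.NumberTheory.EllipticCurves.Rank1Residual

namespace Summit.BirchSwinnertonDyer.BirchSwinnertonDyer.Theorems.PrintCf2.DisegniPairTwo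

/-- **`j(A) = −3375` for every model of a twist `49a1^{(d)}`, `d ≡ 1 (mod 4)`**: `A` is carried to the integral model
`W_k = [1, −(3k+1), 0, −2d², −d³]` (`d = 4k+1`) by a change of variables, and `j(W_k) = −3375` (`cm7Twist_j`).
[cite: SilvermanAEC2009, III.1 and X.5] -/
theorem j_eq_of_cm7_quadraticTwist {d : ℤ} (hd : d % 4 = 1) (A : WeierstrassCurve ℚ) [A.IsElliptic] (C : VariableChange ℚ)
    (hC : C • A = cm7.quadraticTwist (d : ℚ)) : A.j = -3375 := by
  obtain ⟨k, rfl⟩ : ∃ k : ℤ, d = 4 * k + 1 := ⟨d / 4, by omega⟩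
  set D : VariableChange ℚ := (⟨1, 0, 1 / 2, 0⟩ : VariableChange ℚ) * C with hD
  have hDM : D • A = (⟨1, -(3 * k + 1), 0, -2 * (4 * k + 1) ^ 2, -(4 * k + 1) ^ 3⟩ : WeierstrassCurve ℤ).map
      (Int.castRingHom ℚ) := by
    rw [hD, mul_smul, hC, cm7_quadraticTwist_smul_eq]
  have hDA : D • A = (⟨1, -(3 * (k : ℚ) + 1), 0, -2 * (4 * (k : ℚ) + 1) ^ 2, -(4 * (k : ℚ) + 1) ^ 3⟩ :
      WeierstrassCurve ℚ) := by
    rw [hDM]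
    ext <;> simp [WeierstrassCurve.map]
  rw [← variableChange_j A D]
  exact cm7Twist_j (D • A) k hDA

/-- ★ **The absorbed twist is good ORDINARY at `2`**: for `d ≡ 1 (mod 4)` and every globally minimal elliptic `A` with
`C • A = cm7.quadraticTwist d`, `Rank1Residual.GoodOrd A 2` (`2 ∤ N`, `2 ∤ a_2`). [cite: Lang1987, Ch. 13 §4 Thm. 12]
[cite: SilvermanAEC2009, VII.1 Remark 1.1 and X.5] -/
theorem goodOrd_two_of_cm7_quadraticTwist [Fact (2 : ℕ).Prime] {d : ℤ} (hd : d % 4 = 1) (A : WeierstrassCurve ℚ) [A.IsElliptic]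
    [A.IsGloballyMinimal] (C : VariableChange ℚ) (hC : C • A = cm7.quadraticTwist (d : ℚ)) : GoodOrd A 2 := by
  refine Rank1Residual.X12.goodOrd_two_of_cmFieldDiscrOfJ_eq_neg_seven A
    (cm7_quadraticTwist_hasGoodReductionAtPrime_two hd A C hC) ?_
  rw [j_eq_of_cm7_quadraticTwist hd A C hC]
  norm_num [cmFieldDiscrOfJ]

/-- ★★ **Disegni's hypothesis at the road-(C) point: the absorbed twist `A′ = 49a1^{(d′)}`, `d′ ≡ 1 (mod 4)`, has POTENTIALLY GOOD
ORDINARY reduction at `2`** (indeed good ordinary over `ℚ` itself; `WeierstrassCurve.HasPotentiallyGoodOrdinaryReductionAtPrime`).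
[cite: Lang1987, Ch. 13 §4 Thm. 12] [cite: GreenbergLNM1716, Thm 1.2 and §4 p. 103] -/
theorem hasPotentiallyGoodOrdinaryReductionAtPrime_two_of_cm7_quadraticTwist [Fact (2 : ℕ).Prime] {d : ℤ} (hd : d % 4 = 1)
    (A : WeierstrassCurve ℚ) [A.IsElliptic] [A.IsGloballyMinimal] (C : VariableChange ℚ)
    (hC : C • A = cm7.quadraticTwist (d : ℚ)) : A.HasPotentiallyGoodOrdinaryReductionAtPrime 2 :=
  hasPotentiallyGoodOrdinaryReductionAtPrime_of_goodOrd (W := A) (p := 2) (goodOrd_two_of_cm7_quadraticTwist hd A C hC)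

/-! ## §2. The «`E_v/F_v` split» antecedent by name: `2` splits in the CM field `ℚ(√−7)` -/

/-- ★ **The split antecedent for the absorbed twist**: `Rank1Residual.CMSplit A 2` (`2 ∤ d_K = −7`, `−7 ≡ 1 (mod 8)`) for every
model `A` of `49a1^{(d)}`, `d ≡ 1 (mod 4)` — Disegni's hypothesis «`E_v/F_v` split for `v ∣ p`» (Thm. B) at the road-(C) point
`E = K = ℚ(√−7)`, `p = 2`; via `j(A) = −3375` and BCST's `cmSplit_two_of_cmFieldDiscrOfJ_eq` (the `j`-form is
`GoldfeldGoodTwists.cmSplit_two_of_j_eq_neg3375`). [cite: Lang1987, Ch. 13 §4 Thm. 12] [cite: SilvermanATAEC1994, App. A §3] -/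
theorem cmSplit_two_of_cm7_quadraticTwist {d : ℤ} (hd : d % 4 = 1) (A : WeierstrassCurve ℚ) [A.IsElliptic]
    (C : VariableChange ℚ) (hC : C • A = cm7.quadraticTwist (d : ℚ)) : CMSplit A 2 := by
  refine BurungaleCastellaSkinnerTian2022.cmSplit_two_of_cmFieldDiscrOfJ_eq A ?_
  rw [j_eq_of_cm7_quadraticTwist hd A C hC]
  norm_num [cmFieldDiscrOfJ]

/-! ## §3. The same in the `IsOrdinaryAt` currency of the `p`-adic `L`-function files -/

/-- ★ **`IsOrdinaryAt A 2`** (the tree's «(good) ordinary at `p`» of `PAdicLFunction.lean`: good reduction at `2` and `2 ∤ a_2`)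
for every globally minimal model `A` of `49a1^{(d)}`, `d ≡ 1 (mod 4)` — the currency in which the unit root `α_2` and the
`2`-adic `L`-function `padicLFunction_unitRoot` are stated. [cite: Lang1987, Ch. 13 §4 Thm. 12] [cite: GreenbergLNM1716, §4 p. 103] -/
theorem isOrdinaryAt_two_of_cm7_quadraticTwist [Fact (2 : ℕ).Prime] {d : ℤ} (hd : d % 4 = 1) (A : WeierstrassCurve ℚ)
    [A.IsElliptic] [A.IsGloballyMinimal] (C : VariableChange ℚ) (hC : C • A = cm7.quadraticTwist (d : ℚ)) :
    IsOrdinaryAt A 2 :=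
  (isOrdinaryAt_iff A 2).mpr (goodOrd_two_of_cm7_quadraticTwist hd A C hC)

end Summit.BirchSwinnertonDyer.BirchSwinnertonDyer.Theorems.PrintCf2.DisegniPairTwo

end
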